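import Mathlib
import Literature.AlgebraicGeometry.Resolution.CobordantGame
import Literature.AlgebraicGeometry.Resolution.CobordantChartCoefficients
import Literature.AlgebraicGeometry.Resolution.CobordantChartPlaneSlice
import Literature.AlgebraicGeometry.Resolution.AxisPolyhedron
import Summits.ResolutionOfSingularities.ResolutionOfSingularities.Theorems.WeightedInvariantLocalWeightedDropTangentConeCut
import Summits.ResolutionOfSingularities.ResolutionOfSingularities.Theorems.WeightedInvariantLocalWeightedDropApexFreeOrderDrop

/-!
# `WeightedInvariant.LocalWeightedDrop`, line `hasse-ridge-face-selection`: the point move from an axis germ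

Crux item stmt-ResolutionOfSingularities-8899 (route `ResolutionOfSingularities/WeightedInvariant`),
skeleton v18 of the line `hasse-ridge-face-selection`, stub `stub_axisPointMove` (B3), PROVED here
(statement verbatim from the ledger registration).

**Statement.**  In characteristic `p`, a singular germ `S ∈ k[[x'₁, …, x'ₙ, z]]` of order `d` whose
degree-`d` form involves no `z` (`AxisCone`), has trivial apex inside `z = 0` (`TrivialApexX`), and
which carries a monomial `x'^a z^c` with `|a| < d`, `c < 2 (d - |a|)` (`¬ AboveLevel d 2 1 S`, i.e.
Hironaka's `δ(S; x'; z) < 2`) is WON in the local weighted resolution game, given that every singular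
germ of smaller order in the same number of variables is won.

**Proof.**  Blow up the origin (the move `(X, (1, …, 1))`, `TangentConeCut.isMove_X_one`).  A singular
successor `G` sits at an exceptional point `c ≠ 0` with `S(s(c + y)) = sᵃ · G`, `s ∤ G`; every slot has
weight `1`, so at a slot `i₀` with `c_{i₀} ≠ 0` the tame slice `Sl := G|_{y_{i₀} = 0}` satisfies
`G = u · Φ(cyl Sl)` (`tameSlice`), and `G` is won as soon as `ord Sl < d` (hypothesis on smaller orders,
or `wonBy_zero_of_not_isSingular`; then `won_cyl`, `won_subst_iff`, `won_unit_mul_iff`) — exactly as in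
`TangentConeCut.apexFreeStartsWon`.
* Off the axis (`c' := c|_{x'} ≠ 0`): slice at an `x'`-slot.  If `ord Sl ≥ d`, `stub_apexFreeOrderDrop`
  makes `c` a translation-invariance vector of the degree-`d` form; by `AxisCone` that form only sees the
  `x'`-coordinates (`initEval_eq_of_axisCone`), so `(c', 0)` is an invariance vector inside `z = 0`,
  contradicting `TrivialApexX`.
* At the axis point (`c' = 0`, `c_z ≠ 0`): slice at the `z`-slot.  The chart is `x' = s y'`,
  `z = s (c_z + y_z)`; killing `y_z` and dividing by `s^d` (`a = d`), the monomial `x'^b z^γ` of `S`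
  becomes `S_{b,γ} c_z^γ s^{|b| + γ - d} y'^b`, and distinct `(b, γ)` give distinct monomials, so
  `coeff (|b| + γ - d, b) Sl = S_{b,γ} c_z^γ` (`coeff_axisSlice`, from `coeff_subst_slice`,
  `coeff_cons_of_eq_X_pow_mul`, `coeff_subst_chart`).  For the witness of `¬ AboveLevel d 2 1 S` this is
  non-zero of degree `2|b| + γ - d < d`, whence `ord Sl < d` (`order_axisSlice_lt`).
-/

set_option linter.dupNamespace false -- mandated namespace of this single-conjunct summit

namespace Summit.ResolutionOfSingularities.ResolutionOfSingularities.Theorems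

open Literature.AlgebraicGeometry.Resolution

namespace AxisPointMove

variable {k : Type} [Field k] {n : ℕ}

/-! ### The degree-`d` form of an axis germ only sees the `x'`-coordinates -/

/-- Under `AxisCone d S` the evaluation `in_d S (w)` of the degree-`d` form depends only on the first `n`
coordinates of `w` (every exponent of degree `d` with non-zero coefficient has `z`-component `0`). -/
theorem initEval_eq_of_axisCone {d : ℕ} {S : MvPowerSeries (Fin (n + 1)) k}
    (hS : AxisPolyhedron.AxisCone d S) {w w' : Fin (n + 1) → k}
    (h : ∀ j : Fin n, w (Fin.castSucc j) = w' (Fin.castSucc j)) :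
    CobordantChart.initEval (fun _ : Fin (n + 1) => 1) w d S =
      CobordantChart.initEval (fun _ : Fin (n + 1) => 1) w' d S := by
  rw [ApexFreeOrderDrop.initEval_one_eq_sum, ApexFreeOrderDrop.initEval_one_eq_sum]
  refine Finset.sum_congr rfl fun e he => ?_
  by_cases hez : e (Fin.last n) = 0
  · rw [Fin.prod_univ_castSucc, Fin.prod_univ_castSucc, hez, pow_zero, pow_zero, mul_one, mul_one,
      Finset.prod_congr rfl fun j _ => by rw [h j]]
  · have hdeg : e.degree = d := by
      rw [← ApexFreeOrderDrop.weight_one_eq_degree]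
      exact (ApexFreeOrderDrop.mem_antidiag_iff d e).mp he
    rw [hS e hdeg hez, zero_mul, zero_mul]

/-! ### The `z`-slot slice at the axis point -/

/-- On `Fin (n + 1)`, erasing the last slot does not change the values at the `x'`-slots. -/
theorem erase_last_castSucc (E : Fin (n + 1) →₀ ℕ) (j : Fin n) :
    (E.erase (Fin.last n)) (Fin.castSucc j) = E (Fin.castSucc j) :=
  Finsupp.erase_ne (Fin.castSucc_lt_last j).ne

/-- Exponent bookkeeping of the `z`-slot slice: transporting the exponent `(r, b)` of `s^r y'^b`
(slice variables `s, y'₁, …, y'ₙ`) along `Fin.castSucc` gives `(r, b, 0)`; with `b` the `x'`-part of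
`E` this is `Finsupp.cons r (E.erase z)`. -/
theorem mapDomain_castSucc_cons (r : ℕ) (E : Fin (n + 1) →₀ ℕ) :
    Finsupp.mapDomain (Fin.castSucc : Fin (n + 1) → Fin (n + 2))
        (Finsupp.cons r (Finsupp.equivFunOnFinite.symm fun j : Fin n => E (Fin.castSucc j))) =
      Finsupp.cons r (E.erase (Fin.last n)) := by
  ext j
  refine Fin.cases ?_ (fun i => ?_) j
  · rw [Finsupp.cons_zero, show (0 : Fin (n + 2)) = Fin.castSucc (0 : Fin (n + 1)) from rfl,
      Finsupp.mapDomain_apply (Fin.castSucc_injective _), Finsupp.cons_zero]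
  · rw [Finsupp.cons_succ]
    refine Fin.lastCases ?_ (fun j' => ?_) i
    · rw [Finsupp.erase_same, Finsupp.mapDomain_notin_range]
      rintro ⟨x, hx⟩
      exact (Fin.castSucc_lt_last x).ne hx
    · rw [erase_last_castSucc, show (Fin.castSucc j').succ = Fin.castSucc j'.succ from rfl,
        Finsupp.mapDomain_apply (Fin.castSucc_injective _), Finsupp.cons_succ,
        Finsupp.coe_equivFunOnFinite_symm]

/-- The degree of the flattened exponent `(r, b)` is `r + |b|`. -/
theorem degree_cons_xPart (r : ℕ) (E : Fin (n + 1) →₀ ℕ) :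
    (Finsupp.cons r (Finsupp.equivFunOnFinite.symm fun j : Fin n => E (Fin.castSucc j))).degree =
      r + AxisPolyhedron.xDeg E := by
  rw [Finsupp.degree_eq_sum, Fin.sum_univ_succ, Finsupp.cons_zero]
  simp only [Finsupp.cons_succ, Finsupp.coe_equivFunOnFinite_symm]
  rfl

/-- COEFFICIENTS OF THE `z`-SLOT SLICE AT THE AXIS POINT.  At an exceptional point `c = (0, …, 0, c_z)`
of the point blow-up (chart `x'ⱼ = s yⱼ`, `z = s (c_z + y_z)`) with `S(chart) = sᵃ · G`, the slice
`G|_{y_z = 0}` (variables `s, y'`) has at the exponent `(|E| - a, x'-part of E)` the coefficient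
`S_E · c_z^{E_z}`: the monomial `x'^b z^γ` contributes `S_{b,γ} c_z^γ s^{|b| + γ - a} y'^b`, and
`(b, |b| + γ)` determines `(b, γ)`. -/
theorem coeff_axisSlice {S : MvPowerSeries (Fin (n + 1)) k} {c : Fin (n + 1) → k}
    (hc : ∀ j : Fin n, c (Fin.castSucc j) = 0) {a : ℕ} {G : MvPowerSeries (Fin (n + 2)) k}
    (hfac : MvPowerSeries.subst (CobordantChart.chart (fun _ : Fin (n + 1) => 1) c) S =
      MvPowerSeries.X 0 ^ a * G)
    {E : Fin (n + 1) →₀ ℕ} (ha : a ≤ E.degree) :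
    MvPowerSeries.coeff (Finsupp.cons (E.degree - a)
        (Finsupp.equivFunOnFinite.symm fun j : Fin n => E (Fin.castSucc j)))
      (MvPowerSeries.subst (fun j : Fin (n + 2) => if j = (Fin.last n).succ then
        (0 : MvPowerSeries (Fin (n + 1)) k) else MvPowerSeries.X (Fin.predAbove (Fin.last n) j)) G) =
      MvPowerSeries.coeff E S * c (Fin.last n) ^ E (Fin.last n) := by
  have hsa : (Fin.last n).succ.succAbove = (Fin.castSucc : Fin (n + 1) → Fin (n + 2)) :=
    Fin.succAbove_last
  rw [CobordantChartPlaneSlice.coeff_subst_slice (Fin.last n) G, hsa, mapDomain_castSucc_cons,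
    CobordantChart.coeff_cons_of_eq_X_pow_mul hfac, Nat.add_sub_of_le ha,
    CobordantChart.coeff_subst_chart _ c (fun i hi => absurd hi one_ne_zero), finsum_eq_single _ E]
  · -- the surviving term `e = E`
    rw [if_pos (ApexFreeOrderDrop.weight_one_eq_degree E)]
    simp only [Fin.prod_univ_castSucc, erase_last_castSucc, Finsupp.erase_same, Nat.choose_self,
      Nat.choose_zero_right, Nat.cast_one, one_mul, Nat.sub_self, Nat.sub_zero, pow_zero,
      Finset.prod_const_one]
  · -- every other exponent contributes `0`
    intro e he
    split_ifs with hw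
    · by_cases hx : ∃ j : Fin n, e (Fin.castSucc j) ≠ E (Fin.castSucc j)
      · obtain ⟨j, hj⟩ := hx
        have hzero : (((e (Fin.castSucc j)).choose ((E.erase (Fin.last n)) (Fin.castSucc j)) : k) *
            c (Fin.castSucc j) ^ (e (Fin.castSucc j) - (E.erase (Fin.last n)) (Fin.castSucc j))) = 0 := by
          rw [erase_last_castSucc, hc j]
          rcases lt_or_gt_of_ne hj with hlt | hgt
          · rw [Nat.choose_eq_zero_of_lt hlt, Nat.cast_zero, zero_mul]
          · rw [zero_pow (Nat.sub_ne_zero_of_lt hgt), mul_zero]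
        rw [Finset.prod_eq_zero (Finset.mem_univ (Fin.castSucc j)) hzero, mul_zero]
      · push Not at hx
        exfalso
        apply he
        have hdeg : e.degree = E.degree := by
          rw [← ApexFreeOrderDrop.weight_one_eq_degree]
          exact hw
        have hsum : ∑ j : Fin n, e (Fin.castSucc j) = ∑ j : Fin n, E (Fin.castSucc j) :=
          Finset.sum_congr rfl fun j _ => hx j
        rw [Finsupp.degree_eq_sum, Finsupp.degree_eq_sum, Fin.sum_univ_castSucc, Fin.sum_univ_castSucc,
          hsum] at hdeg
        ext i
        refine Fin.lastCases ?_ (fun j => hx j) i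
        exact Nat.add_left_cancel hdeg
    · rfl

/-- THE `z`-SLOT SLICE AT THE AXIS POINT DROPS BELOW `d` when `δ(S; x'; z) < 2`: for `S` of order `d`
with a monomial `x'^b z^γ`, `|b| < d`, `γ < 2 (d - |b|)`, and an exceptional point `c = (0, c_z)`,
`c_z ≠ 0`, with `S(chart) = s^d · G`, the slice `G|_{y_z = 0}` has order `< d` (it contains the monomial
`s^{|b| + γ - d} y'^b` of degree `2|b| + γ - d < d`, `coeff_axisSlice`). -/
theorem order_axisSlice_lt {S : MvPowerSeries (Fin (n + 1)) k} {c : Fin (n + 1) → k}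
    (hc : ∀ j : Fin n, c (Fin.castSucc j) = 0) (hcz : c (Fin.last n) ≠ 0) {d : ℕ}
    {G : MvPowerSeries (Fin (n + 2)) k}
    (hfac : MvPowerSeries.subst (CobordantChart.chart (fun _ : Fin (n + 1) => 1) c) S =
      MvPowerSeries.X 0 ^ d * G)
    (hSd : S.order = d) (hlev : ¬ AxisPolyhedron.AboveLevel d 2 1 S) :
    (MvPowerSeries.subst (fun j : Fin (n + 2) => if j = (Fin.last n).succ then
        (0 : MvPowerSeries (Fin (n + 1)) k) else MvPowerSeries.X (Fin.predAbove (Fin.last n) j)) G).order <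
      (d : ℕ∞) := by
  -- a monomial `x'^b z^γ` of `S` below the level `2`
  obtain ⟨E, hEx, hEz, hES⟩ : ∃ E : Fin (n + 1) →₀ ℕ, AxisPolyhedron.xDeg E < d ∧
      1 * E (Fin.last n) < 2 * (d - AxisPolyhedron.xDeg E) ∧ MvPowerSeries.coeff E S ≠ 0 := by
    by_contra hno
    push Not at hno
    exact hlev hno
  have hdegE : E.degree = AxisPolyhedron.xDeg E + E (Fin.last n) := by
    rw [Finsupp.degree_eq_sum, Fin.sum_univ_castSucc]
    rfl
  -- `|E| ≥ d` since `S` has order `d`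
  have hdE : d ≤ E.degree := by
    by_contra hlt
    push Not at hlt
    exact hES (MvPowerSeries.coeff_of_lt_order (by rw [hSd]; exact_mod_cast hlt))
  -- the flattened monomial of the slice is non-zero and has degree `< d`
  have hne := (coeff_axisSlice hc hfac hdE).trans_ne (mul_ne_zero hES (pow_ne_zero _ hcz))
  refine lt_of_le_of_lt (MvPowerSeries.order_le hne) ?_
  rw [degree_cons_xPart]
  exact_mod_cast (show E.degree - d + AxisPolyhedron.xDeg E < d by omega)

end AxisPointMove

open AxisPointMove in
/-- THE POINT MOVE FROM AN AXIS GERM WITH `δ < 2`, stub `stub_axisPointMove` (B3) of the line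
`hasse-ridge-face-selection` of crux `LocalWeightedDrop` (stmt-ResolutionOfSingularities-8899),
characteristic `p`.  A singular `S` of order `d` with `AxisCone`, `TrivialApexX` and some monomial
`x'^a z^c`, `|a| < d`, `c < 2(d - |a|)` is won given the singular germs of smaller order: blow up the
point `(X, (1,…,1))`; at `c ≠ 0` off the axis the slice has order `< d` (`stub_apexFreeOrderDrop`: slice
order `d` forces translation invariance by `c`, and with `AxisCone` + `TrivialApexX` the invariance vectors
are the multiples of `e_z`); at the axis point `(0, c_z)` the `z`-slot slice is
`Σ S_{a,c} s^{|a|+c-d} y'^a c_z^c`, containing a monomial of degree `2|a| + c - d < d`; every point has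
weight `1` (tame), so `tameSlice` + the hypothesis + `won_cyl`/`won_subst_iff`/`won_unit_mul_iff` finish. -/
theorem stub_axisPointMove : ∀ (p : ℕ), p.Prime → ∀ (k : Type) [Field k] [CharP k p] (n d : ℕ)
    (S : MvPowerSeries (Fin (n + 1)) k), CobordantGame.IsSingular k S → S.order = d →
    AxisPolyhedron.AxisCone d S → AxisPolyhedron.TrivialApexX d S → ¬ AxisPolyhedron.AboveLevel d 2 1 S →
    (∀ h : MvPowerSeries (Fin (n + 1)) k, CobordantGame.IsSingular k h → h.order < S.order →
      CobordantGame.Won k (n + 1) h) →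
    CobordantGame.Won k (n + 1) S := by
  intro p hp k _ _ n d S hS hSd hcone hapex hlev hord
  refine CobordantGame.Won.move MvPowerSeries.X (fun _ => 1) (TangentConeCut.isMove_X_one (Nat.succ_pos n))
    fun G hG => ?_
  obtain ⟨c, a, ⟨i₁, -, hci₁⟩, hfac, hndvd, -⟩ := hG
  -- the crux's chart with all weights `1` is `chart 1 c`, and `subst X S = S`
  have hchart : CobordantGame.cruxChart k (fun _ : Fin (n + 1) => 1) c =
      CobordantChart.chart (fun _ : Fin (n + 1) => 1) c := by
    have h := CobordantChart.cruxChart_eq_chart (k := k) (fun _ : Fin (n + 1) => 1) c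
    simp only [Nat.one_pos, if_true] at h
    exact h
  have hself : MvPowerSeries.subst (MvPowerSeries.X : Fin (n + 1) → MvPowerSeries (Fin (n + 1)) k) S = S := by
    rw [MvPowerSeries.subst_self]; rfl
  rw [hchart, hself] at hfac
  -- THE SLICING STEP: at a slot `i₀` with `c_{i₀} ≠ 0` (weight `1`, tame) whose slice has order `< d`,
  -- the slice is won, and with it `G = u · Φ₂(cyl slice)`
  have key : ∀ i₀ : Fin (n + 1), c i₀ ≠ 0 →
      (MvPowerSeries.subst (fun j : Fin (n + 2) => if j = i₀.succ then (0 : MvPowerSeries (Fin (n + 1)) k)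
        else MvPowerSeries.X (Fin.predAbove i₀ j)) G).order < (d : ℕ∞) →
      CobordantGame.Won k (n + 2) G := by
    intro i₀ hci₀ hSlt
    have hp1 : ¬ p ∣ (fun _ : Fin (n + 1) => 1) i₀ := fun h => hp.one_lt.ne' (Nat.dvd_one.mp h)
    obtain ⟨Φ₂, u, hΦ0, hΦdet, hu, hGu⟩ :=
      tameSlice p hp k (n + 1) S (fun _ => 1) c (fun i hi => absurd hi one_ne_zero) a G hfac i₀ hci₀ hp1
    set Sl : MvPowerSeries (Fin (n + 1)) k := MvPowerSeries.subst
      (fun j : Fin (n + 2) => if j = i₀.succ then (0 : MvPowerSeries (Fin (n + 1)) k)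
        else MvPowerSeries.X (Fin.predAbove i₀ j)) G with hSl
    have hWSl : CobordantGame.Won k (n + 1) Sl := by
      by_cases hSs : CobordantGame.IsSingular k Sl
      · exact hord Sl hSs (hSd ▸ hSlt)
      · exact (wonBy_zero_of_not_isSingular (Nat.succ_pos n) hSs).won
    rw [hGu]
    exact (won_unit_mul_iff hu _).mpr ((won_subst_iff hΦ0 hΦdet _).mpr (won_cyl i₀.succ hWSl))
  by_cases hc' : ∃ j : Fin n, c (Fin.castSucc j) ≠ 0
  · -- (i) OFF THE AXIS: slice at an `x'`-slot; order `≥ d` would put `(c', 0)` in the apex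
    obtain ⟨j, hj⟩ := hc'
    refine key (Fin.castSucc j) hj ?_
    by_contra hge
    push Not at hge
    have hinv := stub_apexFreeOrderDrop p hp k (n + 1) S d hSd c a G hfac hndvd (Fin.castSucc j) hj hge
    obtain ⟨v', hv'⟩ := hapex (fun j => c (Fin.castSucc j)) (fun h0 => hj (congrFun h0 j))
    refine hv' ((initEval_eq_of_axisCone hcone fun j' => ?_).trans (hinv _))
    simp
  · -- (ii) THE AXIS POINT `c = (0, c_z)`: slice at the `z`-slot, whose order drops since `δ < 2`
    push Not at hc'
    have hcz : c (Fin.last n) ≠ 0 := by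
      rcases Fin.eq_castSucc_or_eq_last i₁ with ⟨j, rfl⟩ | rfl
      · exact absurd (hc' j) hci₁
      · exact hci₁
    refine key (Fin.last n) hcz ?_
    -- `a = d` (the order is the weighted order for the weights `1`)
    have had : a = d := by
      have h : (a : ℕ∞) = S.weightedOrder (fun _ : Fin (n + 1) => 1) :=
        CobordantChart.eq_weightedOrder_of_factor _ c (fun i hi => absurd hi one_ne_zero) hS.1 hfac hndvd
      change (a : ℕ∞) = S.order at h
      rw [hSd] at h
      exact_mod_cast h
    rw [had] at hfac
    exact order_axisSlice_lt hc' hcz hfac hSd hlev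

end Summit.ResolutionOfSingularities.ResolutionOfSingularities.Theorems
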